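import Mathlib
import HarnessLib
import Summits.Parity.BatemanHorn.Theses.AlmostPrimeZeros
import Summits.Parity.BatemanHorn.Theorems.AlmostPrimeZerosLinearCappedRepulsionTilted

/-!
# Crux `SystemMomentDeficit` (stmt-Parity-11326), line `Sketch`: K1 holds for the system `(X)`

The open registered stub of the line `Sketch` (idea `small-circle-jensen`) is K1
`stub_smallCircleJensen`: for every Bateman–Horn system `f` there are `r > 0`, `A ≥ 0`, `x₀` such that
for every `x ≥ x₀` some real tilt `a` makes the angular mean of
`log⁺ ‖S_x(z) e^{−a(z−1)}/(x+1)‖` over `‖z − 1‖ = r` at most `A` (`S_x(z) = Σ_{n ≤ x} z^{s_f(n)}`).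

This file proves the conclusion of K1 for the one-member linear system `(X)` (`k = 1`, `s_f(n) = s(n) =
Σ_{p^v ∥ n} min(v, 2)`), with `r = 1` and the natural tilt `a = log log x`, from the landed one-sided
tilted Selberg–Delange majorant of the crux line `jensen-stieltjes-majorant` of `LinearCappedRepulsion`
(`…LinearCappedRepulsion.JensenStieltjesMajorant.tiltedMajorant`:
`‖Σ_{n≤x} z^{s(n)}‖ ≤ (x+1) exp(log log x (Re z − 1) + A(1+‖z−1‖)^{3/2})` on `‖z−1‖ ≤ log log x / C`):
on the circle `‖z − 1‖ = 1` the tilt cancels the harmonic exponent exactly, so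
`‖S_x(z)e^{−a(z−1)}/(x+1)‖ ≤ e^{2^{3/2} A}` pointwise and the circle mean of `log⁺` is at most
`2^{3/2} A` (`smallCircleJensen_X`) — the `k = 1` calibration of K1 (with the line's landed two-sided transfer
`abs_deficit_le_of_circleAverage` of `…SystemMomentDeficitOfDiscMajorantLog` it yields
`|m₁(x) − v(x)| ≤ C` for `(X)`).

K1 itself stays open for every system with `Σ deg f_i ≥ 2` and for linear systems with `k ≥ 2`.
-/

noncomputable section

namespace Summit.Parity.BatemanHorn.Cruxes.SystemMomentDeficit.SmallCircle

open scoped BigOperators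
open Polynomial
open Summit.Parity.BatemanHorn.Theses.AlmostPrimeZeros

/-- The statistic of the system `(X)` is the capped number of prime factors `s(n) = Σ_{p^v ∥ n} min(v,2)`. -/
theorem systemStatistic_X (n : ℕ) :
    (∑ i : Fin 1, (((![(Polynomial.X : Polynomial ℤ)] i).eval (n : ℤ)).toNat.factorization.sum fun _ v => min v 2)) =
      n.factorization.sum fun _ v => min v 2 := by
  simp

/-- **K1 (`SmallCircleJensen`) for the system `(X)`**: with `r = 1` and the tilt `a = log log x`,
the angular mean of `log⁺ ‖S_x(z) e^{−a(z−1)}/(x+1)‖` over `‖z − 1‖ = 1` is bounded, uniformly in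
large `x` (pointwise bound `e^{2^{3/2}A}` from the tilted Selberg–Delange majorant `tiltedMajorant`). -/
theorem smallCircleJensen_X :
    ∃ r A : ℝ, ∃ x₀ : ℕ, 0 < r ∧ 0 ≤ A ∧ ∀ x : ℕ, x₀ ≤ x → ∃ a : ℝ,
      Real.circleAverage (fun z : ℂ => Real.posLog
        ‖(∑ n ∈ Finset.range (x + 1),
            z ^ (∑ i : Fin 1, (((![(Polynomial.X : Polynomial ℤ)] i).eval (n : ℤ)).toNat.factorization.sum
              fun _ v => min v 2))) *
          Complex.exp (-((a : ℂ) * (z - 1))) / ((x : ℂ) + 1)‖) 1 r ≤ A := by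
  obtain ⟨A, hA, C, hC, x₀, h⟩ :=
    Summit.Parity.BatemanHorn.Cruxes.LinearCappedRepulsion.JensenStieltjesMajorant.tiltedMajorant
  refine ⟨1, A * 2 ^ (3 / 2 : ℝ), max x₀ ⌈Real.exp (Real.exp C)⌉₊, one_pos, by positivity,
    fun x hx => ⟨Real.log (Real.log (x : ℝ)), ?_⟩⟩
  have hx₀ : x₀ ≤ x := le_of_max_le_left hx
  have hxexp : Real.exp (Real.exp C) ≤ (x : ℝ) :=
    (Nat.le_ceil _).trans (by exact_mod_cast le_of_max_le_right hx)
  have hxpos : (0 : ℝ) < x := (Real.exp_pos _).trans_le hxexp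
  have hlogx : Real.exp C ≤ Real.log x := (Real.le_log_iff_exp_le hxpos).2 hxexp
  have hlogpos : 0 < Real.log x := (Real.exp_pos C).trans_le hlogx
  have hLC : C ≤ Real.log (Real.log x) := (Real.le_log_iff_exp_le hlogpos).2 hlogx
  set L : ℝ := Real.log (Real.log (x : ℝ)) with hLdef
  apply Real.circleAverage_mono_on_of_le_circle
  · -- `log⁺ ‖G‖` is circle integrable for the entire function `G`
    apply MeromorphicOn.circleIntegrable_posLog_norm
    intro z _
    apply AnalyticAt.meromorphicAt
    apply Differentiable.analyticAt
    fun_prop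
  · intro z hz
    rw [Metric.mem_sphere, dist_eq_norm, abs_one] at hz
    have hzC : ‖z - 1‖ ≤ Real.log (Real.log (x : ℝ)) / C := by
      rw [hz]; exact (one_le_div hC).2 hLC
    have hmaj := h x hx₀ z hzC
    simp only [systemStatistic_X]
    rw [hz] at hmaj
    have hN : ‖(x : ℂ) + 1‖ = (x : ℝ) + 1 := by exact_mod_cast Complex.norm_natCast (x + 1)
    rw [norm_div, norm_mul, Complex.norm_exp, hN]
    simp only [Complex.neg_re, Complex.re_ofReal_mul, Complex.sub_re, Complex.one_re]
    have hx1 : (0 : ℝ) < (x : ℝ) + 1 := by positivity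
    set s : ℝ := ‖∑ n ∈ Finset.range (x + 1), z ^ (n.factorization.sum fun _ v => min v 2)‖ with hs
    have hB : s * Real.exp (-(L * (z.re - 1))) / ((x : ℝ) + 1) ≤ Real.exp (A * 2 ^ (3 / 2 : ℝ)) := by
      rw [div_le_iff₀ hx1]
      have h2 : (1 : ℝ) + 1 = 2 := by norm_num
      rw [h2] at hmaj
      calc s * Real.exp (-(L * (z.re - 1)))
          ≤ ((x : ℝ) + 1) * Real.exp (L * (z.re - 1) + A * 2 ^ (3 / 2 : ℝ)) *
              Real.exp (-(L * (z.re - 1))) :=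
            mul_le_mul_of_nonneg_right hmaj (Real.exp_pos _).le
        _ = Real.exp (A * 2 ^ (3 / 2 : ℝ)) * ((x : ℝ) + 1) := by
            rw [mul_assoc, ← Real.exp_add,
              show L * (z.re - 1) + A * 2 ^ (3 / 2 : ℝ) + -(L * (z.re - 1)) = A * 2 ^ (3 / 2 : ℝ) by ring]
            ring
    have hA2 : 0 ≤ A * 2 ^ (3 / 2 : ℝ) := by positivity
    calc Real.posLog (s * Real.exp (-(L * (z.re - 1))) / ((x : ℝ) + 1))
        ≤ Real.posLog (Real.exp (A * 2 ^ (3 / 2 : ℝ))) := Real.posLog_le_posLog (by positivity) hB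
      _ = A * 2 ^ (3 / 2 : ℝ) := by
          rw [Real.posLog_eq_log (by rw [abs_of_pos (Real.exp_pos _)]; exact Real.one_le_exp hA2),
            Real.log_exp]

end Summit.Parity.BatemanHorn.Cruxes.SystemMomentDeficit.SmallCircle

end
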